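import Mathlib
import HarnessLib
import Summits.HubbardSuperconductivity.HubbardSuperconductivity.Theorems.KLProgrammeC4aPPKernelFamily
import Summits.HubbardSuperconductivity.HubbardSuperconductivity.Theorems.KLProgrammeC4aPPKernelSplitFactor

/-!
# Route `KLProgramme` — crux C4a, S3 brick (B4) «(B4)-UMK1», «(M1)-FAMILY» part 2: the DIAGONAL MAJORANT rows of the family at NEGATIVE loop levels
# (`hKn1/hρ0/hρc/hρtail` of `foldBox_law_rows` for `Kr(−s,·) = P(−s,·)·κ(s/(s+|u|))`) and the JOINT CONTINUITY row `hKc` on `ℝ × ℝ`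

Cell `gate-hubbard-kl`, seat hubbard-kl-k3c3-p1 (g16; row «δμ-flow with klAngularMean constant piece»).  Located brick for the (C)-closer lane's
`…C4aFoldBoxLawRows.foldBox_law_rows` (stmt-HubbardSuperconductivity-20437 (C)/(U1)); part 1 = `…C4aPPKernelFamily`; memo HOME/hubbard-kl-k3c3-p1/g16-M1-NEG-PRE-KERNEL.md §7.

* §1 **`abs_deriv_ppFamilyKernel_negLevel_le_majorant`** (`hKn1`): for `0 < lo ≤ s`, `s/2 ≤ u`,
  `|deriv Kr(−s,·) u| ≤ ρᶠ(s)·max(u−s,lo)⁻¹²`, `ρᶠ(s) = 64·Cᶠ·Λ³/(s+2Λ)³ + Rᶠ·e^{−βs/2}`, `Cᶠ = κ₀C½ + κ₁(12B₁+9)` (`C½ = 64B₂+120B₁+154`),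
  `Rᶠ = κ₀((β·lo)²+2) + κ₁(β·lo+1)` — the `∂ᵤP·S` term by p685823's majorant (`|S| ≤ κ₀`), the `P·S′` term by `|S′| ≤ κ₁/max(s,u)` against the reflected value
  envelope (`s ≤ 2Λ`) and the thermal VALUE sizes `βe^{−βs/2}`, `e^{−βs}/(u−s)` of p685823 (`s > 2Λ`); rows `hρ0`/`hρc` (`familyMajorant_nonneg`,
  `continuousOn_familyMajorant`) and **`intervalIntegral_familyMajorant_tail_le`** (`hρtail`, `Mρᶠ = 32Cᶠ(Λ/lo)³ + 32Rᶠ/(β·lo)³`).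
* §2 **`continuous_deriv_ppFamilyKernel₂`** (`hKc`): `(e,u) ↦ deriv Kr(e,·) u` is continuous on `ℝ × ℝ` — `P`, `∂ᵤP` jointly continuous (p686582), the floored
  split `κ(m(e)/(m(e)+|u|))` and its partner derivative jointly continuous (`m(e) = max(|e|,lo) ≥ lo`: the derivative is the smooth branch formula on `u ≷ 0` and
  vanishes identically on the `e`-uniform neighbourhood `|u| < lo(1−t₁)` of `u = 0`).
Pure real analysis on Literature objects; nothing asserts (C), K3, the window or superconductivity.
References: BGM 2006 §2.4 (2.36) [cite: BenfattoGiulianiMastropietro2006]; Salmhofer 1999 §4.2.5 (4.70)–(4.71) [cite: Salmhofer1999]; FST II CPAM 51 (1998) §3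
[cite: FeldmanSalmhoferTrubowitz1998].
-/

noncomputable section

namespace Summit.HubbardSuperconductivity.HubbardSuperconductivity.Theorems.C4a

set_option linter.dupNamespace false -- summit = problem name (single-conjunct summit), D-0017

open Real Filter Set MeasureTheory intervalIntegral
open scoped Topology Interval
open Literature.MathematicalPhysics.QuantumLattice Literature.Analysis.SpecialFunctions

/-! ## §1 The diagonal majorant of the family at negative loop levels -/

/-- **ROW `hKn1` FOR THE FAMILY.**  `0 < β`, `0 < Λ`, `|χ′| ≤ B₁`, `|χ″| ≤ B₂`; split profile `|κ| ≤ κ₀`, `|κ′| ≤ κ₁` on `[0,1]`, `κ = 0` on `[t₁,∞)`, `t₁ < 1`;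
`0 < lo ≤ s`, `s/2 ≤ u` ⟹ `|deriv Kr(−s,·) u| ≤ (64·Cᶠ·Λ³/(s+2Λ)³ + Rᶠ·e^{−βs/2})·max(u−s,lo)⁻¹²`, `Cᶠ = κ₀(64B₂+120B₁+154) + κ₁(12B₁+9)`,
`Rᶠ = κ₀((β·lo)²+2) + κ₁(β·lo+1)`. [cite: BenfattoGiulianiMastropietro2006, §2.4 (2.36)] -/
theorem abs_deriv_ppFamilyKernel_negLevel_le_majorant {β Λ : ℝ} (hβ : 0 < β) (hΛ : 0 < Λ) {B₁ B₂ : ℝ} (hB₁ : ∀ x, |deriv salmhoferCutoff x| ≤ B₁)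
    (hB₂ : ∀ x, |deriv (deriv salmhoferCutoff) x| ≤ B₂) {κ κ' : ℝ → ℝ} {κ₀ κ₁ t₁ : ℝ} (hκ : ∀ t, HasDerivAt κ (κ' t) t)
    (hκb : ∀ t ∈ Icc 0 1, |κ t| ≤ κ₀) (hκ'b : ∀ t ∈ Icc 0 1, |κ' t| ≤ κ₁) (ht₁ : t₁ < 1) (hκs : ∀ t, t₁ ≤ t → κ t = 0)
    {lo s u : ℝ} (hlo : 0 < lo) (hs : lo ≤ s) (hu : s / 2 ≤ u) :
    |deriv (fun v : ℝ => ppFamilyKernel β Λ κ lo (-s) v) u| ≤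
      (64 * (κ₀ * (64 * B₂ + 120 * B₁ + 154) + κ₁ * (12 * B₁ + 9)) * Λ ^ 3 / (s + 2 * Λ) ^ 3 +
          (κ₀ * ((β * lo) ^ 2 + 2) + κ₁ * (β * lo + 1)) * Real.exp (-(β / 2 * s))) * ((max (u - s) lo)⁻¹ ^ 2) := by
  have hB0 := salmhoferB₁_nonneg hB₁
  have hB20 : 0 ≤ B₂ := (abs_nonneg _).trans (hB₂ 0)
  have hκ₀ : 0 ≤ κ₀ := (abs_nonneg _).trans (hκb 0 (left_mem_Icc.2 zero_le_one))
  have hκ₁ : 0 ≤ κ₁ := (abs_nonneg _).trans (hκ'b 0 (left_mem_Icc.2 zero_le_one))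
  have hs0 : 0 < s := hlo.trans_le hs
  have hu0 : 0 < u := by linarith
  set C : ℝ := 64 * B₂ + 120 * B₁ + 154 with hC
  have hC0 : 0 ≤ C := by rw [hC]; positivity
  set M : ℝ := max (u - s) lo with hM
  have hMlo : lo ≤ M := le_max_right _ _
  have hM0 : 0 < M := hlo.trans_le hMlo
  -- the scale of the split at loop level `−s` is `s`
  have hm : familyScale lo (-s) = s := by rw [familyScale_eq_abs (by rwa [abs_neg, abs_of_pos hs0]), abs_neg, abs_of_pos hs0]
  rw [deriv_ppFamilyKernel hβ hΛ hB₁ hκ ht₁ hκs hlo, hm]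
  -- sizes of the two factors
  have hk : |κ (s / (s + |u|))| ≤ κ₀ := hκb _ (splitArg_mem hs0 u).2.2
  have hS' : |deriv (fun v : ℝ => κ (s / (s + |v|))) u| ≤ κ₁ * (max s u)⁻¹ := by
    have h := abs_deriv_splitWeight_le hκ hκ'b ht₁ hκs hs0 u
    rwa [abs_of_pos hu0] at h
  -- geometry: `max(u−s,lo) ≤ max(s,u)`
  have hMle : M ≤ max s u := max_le (by linarith [le_max_right s u]) (hs.trans (le_max_left _ _))
  have hsu0 : 0 < max s u := hs0.trans_le (le_max_left _ _)
  have hinvM : (max s u)⁻¹ ≤ M⁻¹ := inv_anti₀ hM0 hMle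
  -- (A) the `∂ᵤP·S` term: p685823's majorant times `κ₀`
  have hA : |ppTrueKernelDu β Λ (-s) u * κ (s / (s + |u|))| ≤
      κ₀ * (64 * C * Λ ^ 3 / (s + 2 * Λ) ^ 3 + ((β * lo) ^ 2 + 2) * Real.exp (-(β / 2 * s))) * M⁻¹ ^ 2 := by
    have hP' := abs_ppTrueKernelDu_negLevel_le_majorant hβ hΛ hB₁ hB₂ hlo hs hu
    rw [abs_mul]
    have h0 : 0 ≤ (64 * C * Λ ^ 3 / (s + 2 * Λ) ^ 3 + ((β * lo) ^ 2 + 2) * Real.exp (-(β / 2 * s))) * M⁻¹ ^ 2 := by positivity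
    calc |ppTrueKernelDu β Λ (-s) u| * |κ (s / (s + |u|))|
        ≤ (64 * C * Λ ^ 3 / (s + 2 * Λ) ^ 3 + ((β * lo) ^ 2 + 2) * Real.exp (-(β / 2 * s))) * M⁻¹ ^ 2 * κ₀ := mul_le_mul hP' hk (abs_nonneg _) h0
      _ = _ := by ring
  -- (B) the `P·S′` term
  have hB : |ppTrueKernel β Λ (-s) u * deriv (fun v : ℝ => κ (s / (s + |v|))) u| ≤
      κ₁ * (64 * (12 * B₁ + 9) * Λ ^ 3 / (s + 2 * Λ) ^ 3 + (β * lo + 1) * Real.exp (-(β / 2 * s))) * M⁻¹ ^ 2 := by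
    rw [abs_mul]
    have hpow0 : 0 ≤ 64 * (12 * B₁ + 9) * Λ ^ 3 / (s + 2 * Λ) ^ 3 := by positivity
    have hexp0 : 0 ≤ (β * lo + 1) * Real.exp (-(β / 2 * s)) := by positivity
    rcases le_or_gt s (2 * Λ) with hsΛ | hsΛ
    · -- shell regime: reflected value envelope
      have hP := abs_ppTrueKernel_negLevel_le_inv_max hβ hΛ hB₁ hs0 u
      rw [abs_of_pos hu0] at hP
      have hCle : (12 * B₁ + 9) ≤ 64 * (12 * B₁ + 9) * Λ ^ 3 / (s + 2 * Λ) ^ 3 := by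
        rw [le_div_iff₀ (by positivity)]
        have h3 : (s + 2 * Λ) ^ 3 ≤ (4 * Λ) ^ 3 := pow_le_pow_left₀ (by positivity) (by linarith) 3
        nlinarith
      calc |ppTrueKernel β Λ (-s) u| * |deriv (fun v : ℝ => κ (s / (s + |v|))) u| ≤ (12 * B₁ + 9) * (max s u)⁻¹ * (κ₁ * (max s u)⁻¹) :=
            mul_le_mul hP hS' (abs_nonneg _) (by positivity)
        _ = κ₁ * (12 * B₁ + 9) * (max s u)⁻¹ ^ 2 := by ring
        _ ≤ κ₁ * (64 * (12 * B₁ + 9) * Λ ^ 3 / (s + 2 * Λ) ^ 3) * M⁻¹ ^ 2 := by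
            have h1 : (max s u)⁻¹ ^ 2 ≤ M⁻¹ ^ 2 := pow_le_pow_left₀ (inv_nonneg.2 hsu0.le) hinvM 2
            have h2 : κ₁ * (12 * B₁ + 9) ≤ κ₁ * (64 * (12 * B₁ + 9) * Λ ^ 3 / (s + 2 * Λ) ^ 3) := mul_le_mul_of_nonneg_left hCle hκ₁
            exact mul_le_mul h2 h1 (by positivity) (by positivity)
        _ ≤ κ₁ * (64 * (12 * B₁ + 9) * Λ ^ 3 / (s + 2 * Λ) ^ 3 + (β * lo + 1) * Real.exp (-(β / 2 * s))) * M⁻¹ ^ 2 := by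
            gcongr; linarith
    · -- thermal regime
      have hsfar : Λ < s := by linarith
      rcases le_or_gt (u - s) lo with hnear | hfar
      · have hMeq : M = lo := max_eq_right hnear
        have hP := abs_ppTrueKernel_negLevel_thermal_le hβ hΛ hsΛ hu
        have hS'' : |deriv (fun v : ℝ => κ (s / (s + |v|))) u| ≤ κ₁ * lo⁻¹ :=
          hS'.trans (mul_le_mul_of_nonneg_left (inv_anti₀ hlo (hs.trans (le_max_left _ _))) hκ₁)
        rw [hMeq]
        calc |ppTrueKernel β Λ (-s) u| * |deriv (fun v : ℝ => κ (s / (s + |v|))) u| ≤ β * Real.exp (-(β / 2 * s)) * (κ₁ * lo⁻¹) :=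
              mul_le_mul hP hS'' (abs_nonneg _) (by positivity)
          _ = κ₁ * (β * lo * Real.exp (-(β / 2 * s))) * lo⁻¹ ^ 2 := by field_simp
          _ ≤ κ₁ * (64 * (12 * B₁ + 9) * Λ ^ 3 / (s + 2 * Λ) ^ 3 + (β * lo + 1) * Real.exp (-(β / 2 * s))) * lo⁻¹ ^ 2 := by
              gcongr
              nlinarith [Real.exp_pos (-(β / 2 * s))]
      · have hMeq : M = u - s := max_eq_left hfar.le
        have hsu : s < u := by linarith
        have hP := abs_ppTrueKernel_negLevel_thermal_far_le hβ hΛ hsfar hsu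
        have hexp : Real.exp (-(β * s)) ≤ Real.exp (-(β / 2 * s)) := Real.exp_le_exp.2 (by nlinarith)
        have hS'' : |deriv (fun v : ℝ => κ (s / (s + |v|))) u| ≤ κ₁ * (u - s)⁻¹ :=
          hS'.trans (mul_le_mul_of_nonneg_left (inv_anti₀ (by linarith) (by linarith [le_max_right s u] : u - s ≤ max s u)) hκ₁)
        rw [hMeq]
        calc |ppTrueKernel β Λ (-s) u| * |deriv (fun v : ℝ => κ (s / (s + |v|))) u| ≤ Real.exp (-(β * s)) * (u - s)⁻¹ * (κ₁ * (u - s)⁻¹) :=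
              mul_le_mul hP hS'' (abs_nonneg _) (by positivity)
          _ = κ₁ * Real.exp (-(β * s)) * (u - s)⁻¹ ^ 2 := by ring
          _ ≤ κ₁ * Real.exp (-(β / 2 * s)) * (u - s)⁻¹ ^ 2 := by gcongr
          _ ≤ κ₁ * (64 * (12 * B₁ + 9) * Λ ^ 3 / (s + 2 * Λ) ^ 3 + (β * lo + 1) * Real.exp (-(β / 2 * s))) * (u - s)⁻¹ ^ 2 := by
              gcongr
              nlinarith [Real.exp_pos (-(β / 2 * s)), mul_pos hβ hlo]
  calc |ppTrueKernelDu β Λ (-s) u * κ (s / (s + |u|)) + ppTrueKernel β Λ (-s) u * deriv (fun v : ℝ => κ (s / (s + |v|))) u|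
      ≤ κ₀ * (64 * C * Λ ^ 3 / (s + 2 * Λ) ^ 3 + ((β * lo) ^ 2 + 2) * Real.exp (-(β / 2 * s))) * M⁻¹ ^ 2 +
          κ₁ * (64 * (12 * B₁ + 9) * Λ ^ 3 / (s + 2 * Λ) ^ 3 + (β * lo + 1) * Real.exp (-(β / 2 * s))) * M⁻¹ ^ 2 :=
        (abs_add_le _ _).trans (add_le_add hA hB)
    _ = (64 * (κ₀ * C + κ₁ * (12 * B₁ + 9)) * Λ ^ 3 / (s + 2 * Λ) ^ 3 + (κ₀ * ((β * lo) ^ 2 + 2) + κ₁ * (β * lo + 1)) * Real.exp (-(β / 2 * s))) *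
          M⁻¹ ^ 2 := by ring

/-- **ROW `hKn1` in the binder shape of `foldBox_law_rows`.** [cite: BenfattoGiulianiMastropietro2006, §2.4 (2.36)] -/
theorem abs_deriv_ppFamilyKernel_negLevel_row {β Λ : ℝ} (hβ : 0 < β) (hΛ : 0 < Λ) {B₁ B₂ : ℝ} (hB₁ : ∀ x, |deriv salmhoferCutoff x| ≤ B₁)
    (hB₂ : ∀ x, |deriv (deriv salmhoferCutoff) x| ≤ B₂) {κ κ' : ℝ → ℝ} {κ₀ κ₁ t₁ : ℝ} (hκ : ∀ t, HasDerivAt κ (κ' t) t)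
    (hκb : ∀ t ∈ Icc 0 1, |κ t| ≤ κ₀) (hκ'b : ∀ t ∈ Icc 0 1, |κ' t| ≤ κ₁) (ht₁ : t₁ < 1) (hκs : ∀ t, t₁ ≤ t → κ t = 0)
    {lo hi : ℝ} (hlo : 0 < lo) :
    ∀ s ∈ Icc lo hi, ∀ u, s / 2 ≤ u → |deriv (fun v : ℝ => ppFamilyKernel β Λ κ lo (-s) v) u| ≤
      (64 * (κ₀ * (64 * B₂ + 120 * B₁ + 154) + κ₁ * (12 * B₁ + 9)) * Λ ^ 3 / (s + 2 * Λ) ^ 3 +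
          (κ₀ * ((β * lo) ^ 2 + 2) + κ₁ * (β * lo + 1)) * Real.exp (-(β / 2 * s))) * ((max (u - s) lo)⁻¹ ^ 2) :=
  fun _ hs _ hu => abs_deriv_ppFamilyKernel_negLevel_le_majorant hβ hΛ hB₁ hB₂ hκ hκb hκ'b ht₁ hκs hlo hs.1 hu

/-- **ROW `hρ0`**: the family majorant is nonnegative (`s ≥ 0`). [folklore] -/
theorem familyMajorant_nonneg {β Λ B₁ B₂ κ₀ κ₁ lo : ℝ} (hβ : 0 < β) (hΛ : 0 < Λ) (hB₁ : 0 ≤ B₁) (hB₂ : 0 ≤ B₂) (hκ₀ : 0 ≤ κ₀) (hκ₁ : 0 ≤ κ₁)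
    (hlo : 0 < lo) {s : ℝ} (hs : 0 ≤ s) :
    0 ≤ 64 * (κ₀ * (64 * B₂ + 120 * B₁ + 154) + κ₁ * (12 * B₁ + 9)) * Λ ^ 3 / (s + 2 * Λ) ^ 3 +
      (κ₀ * ((β * lo) ^ 2 + 2) + κ₁ * (β * lo + 1)) * Real.exp (-(β / 2 * s)) := by
  positivity

/-- **ROW `hρc`**: the family majorant is continuous on `[lo,hi]`. [folklore] -/
theorem continuousOn_familyMajorant {β Λ B₁ B₂ κ₀ κ₁ lo hi : ℝ} (hΛ : 0 < Λ) (hlo : 0 < lo) :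
    ContinuousOn (fun s : ℝ => 64 * (κ₀ * (64 * B₂ + 120 * B₁ + 154) + κ₁ * (12 * B₁ + 9)) * Λ ^ 3 / (s + 2 * Λ) ^ 3 +
      (κ₀ * ((β * lo) ^ 2 + 2) + κ₁ * (β * lo + 1)) * Real.exp (-(β / 2 * s))) (Icc lo hi) := by
  refine ContinuousOn.add ?_ (by fun_prop)
  refine ContinuousOn.div (by fun_prop) (by fun_prop) fun s hs => ?_
  have : 0 < s := hlo.trans_le hs.1
  positivity

/-- **ROW `hρtail`** for the family majorant: `Mρᶠ = 32·Cᶠ·(Λ/lo)³ + 32·Rᶠ/(β·lo)³`. [folklore] -/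
theorem intervalIntegral_familyMajorant_tail_le {β Λ B₁ B₂ κ₀ κ₁ lo hi : ℝ} (hβ : 0 < β) (hΛ : 0 < Λ) (hB₁ : 0 ≤ B₁) (hB₂ : 0 ≤ B₂) (hκ₀ : 0 ≤ κ₀)
    (hκ₁ : 0 ≤ κ₁) (hlo : 0 < lo) :
    ∀ a ∈ Icc lo hi, ∫ s in a..hi, (64 * (κ₀ * (64 * B₂ + 120 * B₁ + 154) + κ₁ * (12 * B₁ + 9)) * Λ ^ 3 / (s + 2 * Λ) ^ 3 +
        (κ₀ * ((β * lo) ^ 2 + 2) + κ₁ * (β * lo + 1)) * Real.exp (-(β / 2 * s))) ≤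
      (32 * (κ₀ * (64 * B₂ + 120 * B₁ + 154) + κ₁ * (12 * B₁ + 9)) * (Λ / lo) ^ 3 +
          32 * (κ₀ * ((β * lo) ^ 2 + 2) + κ₁ * (β * lo + 1)) / (β * lo) ^ 3) * (lo * (lo / a) ^ 2) := fun a ha => by
  set C : ℝ := κ₀ * (64 * B₂ + 120 * B₁ + 154) + κ₁ * (12 * B₁ + 9) with hC
  set R : ℝ := κ₀ * ((β * lo) ^ 2 + 2) + κ₁ * (β * lo + 1) with hR
  have hC0 : 0 ≤ C := by rw [hC]; positivity
  have hR0 : 0 ≤ R := by rw [hR]; positivity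
  have ha0 : 0 < a := hlo.trans_le ha.1
  have hcont1 : ContinuousOn (fun s : ℝ => 64 * C * Λ ^ 3 / (s + 2 * Λ) ^ 3) (uIcc a hi) := by
    rw [uIcc_of_le ha.2]
    refine ContinuousOn.div (by fun_prop) (by fun_prop) fun s hs => ?_
    have : 0 < s := ha0.trans_le hs.1
    positivity
  have hi1 : IntervalIntegrable (fun s : ℝ => 64 * C * Λ ^ 3 / (s + 2 * Λ) ^ 3) volume a hi := hcont1.intervalIntegrable
  have hi2 : IntervalIntegrable (fun s : ℝ => R * Real.exp (-(β / 2 * s))) volume a hi :=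
    (by fun_prop : Continuous fun s : ℝ => R * Real.exp (-(β / 2 * s))).intervalIntegrable _ _
  rw [intervalIntegral.integral_add hi1 hi2]
  have h1 := intervalIntegral_cube_tail_le hC0 hΛ hlo ha.1 ha.2
  have h2 := intervalIntegral_exp_tail_le (R := R) (κ := β / 2) hR0 (by positivity) hlo ha.1 hi
  have h2' : 4 * R / (β / 2 * lo) ^ 3 = 32 * R / (β * lo) ^ 3 := by
    field_simp
    ring
  rw [h2'] at h2
  calc (∫ s in a..hi, 64 * C * Λ ^ 3 / (s + 2 * Λ) ^ 3) + ∫ s in a..hi, R * Real.exp (-(β / 2 * s))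
      ≤ 32 * C * (Λ / lo) ^ 3 * (lo * (lo / a) ^ 2) + 32 * R / (β * lo) ^ 3 * (lo * (lo / a) ^ 2) := add_le_add h1 h2
    _ = (32 * C * (Λ / lo) ^ 3 + 32 * R / (β * lo) ^ 3) * (lo * (lo / a) ^ 2) := by ring

/-! ## §2 Joint continuity of the family's partner derivative (`hKc`) -/

/-- The floored split weight is jointly continuous in `(e,u)`. [folklore] -/
theorem continuous_familySplit {κ : ℝ → ℝ} (hκc : Continuous κ) {lo : ℝ} (hlo : 0 < lo) :
    Continuous fun p : ℝ × ℝ => κ (familyScale lo p.1 / (familyScale lo p.1 + |p.2|)) := by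
  have hm : Continuous fun p : ℝ × ℝ => familyScale lo p.1 := by
    unfold familyScale; exact (continuous_abs.comp continuous_fst).max continuous_const
  have hne : ∀ p : ℝ × ℝ, familyScale lo p.1 + |p.2| ≠ 0 := fun p => by
    have := (familyScale_pos hlo p.1).1; positivity
  exact hκc.comp (hm.div (hm.add (continuous_abs.comp continuous_snd)) hne)

/-- **The floored split weight's partner derivative is jointly continuous in `(e,u)`** (`κ′` continuous, `κ′ = 0` on `[t₁,∞)`, `t₁ < 1`, `lo > 0`): on `u > 0` / `u < 0`
it is the smooth branch formula, and it vanishes identically on `|u| < lo(1−t₁)` (uniformly in `e`, since `m(e) ≥ lo`). [folklore] -/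
theorem continuous_deriv_familySplit {κ κ' : ℝ → ℝ} (hκ : ∀ t, HasDerivAt κ (κ' t) t) (hκ'c : Continuous κ') {t₁ : ℝ} (ht₁ : t₁ < 1)
    (hκs : ∀ t, t₁ ≤ t → κ t = 0) (hκ's : ∀ t, t₁ ≤ t → κ' t = 0) {lo : ℝ} (hlo : 0 < lo) :
    Continuous fun p : ℝ × ℝ => deriv (fun v : ℝ => κ (familyScale lo p.1 / (familyScale lo p.1 + |v|))) p.2 := by
  have hm : Continuous fun p : ℝ × ℝ => familyScale lo p.1 := by
    unfold familyScale; exact (continuous_abs.comp continuous_fst).max continuous_const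
  have hmpos : ∀ p : ℝ × ℝ, 0 < familyScale lo p.1 := fun p => (familyScale_pos hlo p.1).1
  refine continuous_iff_continuousAt.2 fun p₀ => ?_
  -- the explicit branch formula at `u ≠ 0`
  have hformula : ∀ p : ℝ × ℝ, p.2 ≠ 0 → deriv (fun v : ℝ => κ (familyScale lo p.1 / (familyScale lo p.1 + |v|))) p.2 =
      κ' (familyScale lo p.1 / (familyScale lo p.1 + |p.2|)) * (-(familyScale lo p.1 * (SignType.sign p.2 : ℝ)) / (familyScale lo p.1 + |p.2|) ^ 2) :=
    fun p hp => (hasDerivAt_splitWeight hκ (hmpos p) hp).deriv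
  rcases lt_trichotomy p₀.2 0 with hneg | hzero | hpos
  · -- `u₀ < 0`: on the open set `{u < 0}` the sign is `−1` and `|u| = −u`
    have hU : IsOpen {p : ℝ × ℝ | p.2 < 0} := isOpen_lt continuous_snd continuous_const
    have hev : (fun p : ℝ × ℝ => deriv (fun v : ℝ => κ (familyScale lo p.1 / (familyScale lo p.1 + |v|))) p.2) =ᶠ[𝓝 p₀] fun p =>
        κ' (familyScale lo p.1 / (familyScale lo p.1 + -p.2)) * (-(familyScale lo p.1 * (-1 : ℝ)) / (familyScale lo p.1 + -p.2) ^ 2) := by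
      filter_upwards [hU.mem_nhds hneg] with p hp
      have hp' : p.2 < 0 := hp
      rw [hformula p hp'.ne, abs_of_neg hp', sign_neg hp']
      simp
    refine ContinuousAt.congr_of_eventuallyEq ?_ hev
    have hden : ∀ p : ℝ × ℝ, p ∈ {p : ℝ × ℝ | p.2 < 0} → familyScale lo p.1 + -p.2 ≠ 0 := fun p hp => by
      have : p.2 < 0 := hp; have := hmpos p; linarith
    have hcont : ContinuousOn (fun p : ℝ × ℝ => κ' (familyScale lo p.1 / (familyScale lo p.1 + -p.2)) *
        (-(familyScale lo p.1 * (-1 : ℝ)) / (familyScale lo p.1 + -p.2) ^ 2)) {p : ℝ × ℝ | p.2 < 0} := by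
      refine ContinuousOn.mul (hκ'c.comp_continuousOn (ContinuousOn.div hm.continuousOn (hm.continuousOn.add continuous_snd.neg.continuousOn) hden)) ?_
      exact ContinuousOn.div (hm.mul continuous_const).neg.continuousOn ((hm.add continuous_snd.neg).pow 2).continuousOn
        fun p hp => pow_ne_zero 2 (hden p hp)
    exact hcont.continuousAt (hU.mem_nhds hneg)
  · -- `u₀ = 0`: the derivative vanishes on the `e`-uniform strip `|u| < lo(1−t₁)`
    have hr : 0 < lo * (1 - t₁) := mul_pos hlo (by linarith)
    have hV : IsOpen {p : ℝ × ℝ | |p.2| < lo * (1 - t₁)} := isOpen_lt (continuous_abs.comp continuous_snd) continuous_const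
    have hp₀V : p₀ ∈ {p : ℝ × ℝ | |p.2| < lo * (1 - t₁)} := by show |p₀.2| < lo * (1 - t₁); rw [hzero, abs_zero]; exact hr
    have hev : (fun p : ℝ × ℝ => deriv (fun v : ℝ => κ (familyScale lo p.1 / (familyScale lo p.1 + |v|))) p.2) =ᶠ[𝓝 p₀] fun _ => (0 : ℝ) := by
      filter_upwards [hV.mem_nhds hp₀V] with p hp
      have hp' : |p.2| < lo * (1 - t₁) := hp
      have hpm : |p.2| ≤ familyScale lo p.1 * (1 - t₁) :=
        hp'.le.trans (mul_le_mul_of_nonneg_right (familyScale_pos hlo p.1).2.2 (by linarith))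
      rcases eq_or_ne p.2 0 with hz | hz
      · rw [hz]; exact (hasDerivAt_splitWeight_zero (hmpos p) ht₁ hκs).deriv
      · rw [hformula p hz, splitWeight_eq_zero_of_abs_le (κ := κ') (hmpos p) ht₁.le hκ's hpm, zero_mul]
    exact continuousAt_const.congr_of_eventuallyEq hev
  · -- `u₀ > 0`
    have hU : IsOpen {p : ℝ × ℝ | 0 < p.2} := isOpen_lt continuous_const continuous_snd
    have hev : (fun p : ℝ × ℝ => deriv (fun v : ℝ => κ (familyScale lo p.1 / (familyScale lo p.1 + |v|))) p.2) =ᶠ[𝓝 p₀] fun p =>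
        κ' (familyScale lo p.1 / (familyScale lo p.1 + p.2)) * (-(familyScale lo p.1 * (1 : ℝ)) / (familyScale lo p.1 + p.2) ^ 2) := by
      filter_upwards [hU.mem_nhds hpos] with p hp
      have hp' : 0 < p.2 := hp
      rw [hformula p hp'.ne', abs_of_pos hp', sign_pos hp']
      simp
    refine ContinuousAt.congr_of_eventuallyEq ?_ hev
    have hden : ∀ p : ℝ × ℝ, p ∈ {p : ℝ × ℝ | 0 < p.2} → familyScale lo p.1 + p.2 ≠ 0 := fun p hp => by
      have : 0 < p.2 := hp; have := hmpos p; linarith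
    have hcont : ContinuousOn (fun p : ℝ × ℝ => κ' (familyScale lo p.1 / (familyScale lo p.1 + p.2)) *
        (-(familyScale lo p.1 * (1 : ℝ)) / (familyScale lo p.1 + p.2) ^ 2)) {p : ℝ × ℝ | 0 < p.2} := by
      refine ContinuousOn.mul (hκ'c.comp_continuousOn (ContinuousOn.div hm.continuousOn (hm.continuousOn.add continuous_snd.continuousOn) hden)) ?_
      exact ContinuousOn.div (hm.mul continuous_const).neg.continuousOn ((hm.add continuous_snd).pow 2).continuousOn
        fun p hp => pow_ne_zero 2 (hden p hp)
    exact hcont.continuousAt (hU.mem_nhds hpos)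

/-- **ROW `hKc` FOR THE FAMILY**: `(e,u) ↦ deriv Kr(e,·) u` is continuous on `ℝ × ℝ`. [cite: BenfattoGiulianiMastropietro2006, §2.4 (2.36)] -/
theorem continuous_deriv_ppFamilyKernel₂ {β Λ : ℝ} (hβ : 0 < β) (hΛ : 0 < Λ) {B₁ : ℝ} (hB₁ : ∀ x, |deriv salmhoferCutoff x| ≤ B₁) {κ κ' : ℝ → ℝ}
    (hκ : ∀ t, HasDerivAt κ (κ' t) t) (hκ'c : Continuous κ') {t₁ : ℝ} (ht₁ : t₁ < 1) (hκs : ∀ t, t₁ ≤ t → κ t = 0) (hκ's : ∀ t, t₁ ≤ t → κ' t = 0)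
    {lo : ℝ} (hlo : 0 < lo) :
    Continuous fun p : ℝ × ℝ => deriv (fun v : ℝ => ppFamilyKernel β Λ κ lo p.1 v) p.2 := by
  have hκc : Continuous κ := continuous_iff_continuousAt.2 fun t => (hκ t).continuousAt
  have hd : (fun p : ℝ × ℝ => deriv (fun v : ℝ => ppFamilyKernel β Λ κ lo p.1 v) p.2) = fun p =>
      ppTrueKernelDu β Λ p.1 p.2 * κ (familyScale lo p.1 / (familyScale lo p.1 + |p.2|)) +
        ppTrueKernel β Λ p.1 p.2 * deriv (fun v : ℝ => κ (familyScale lo p.1 / (familyScale lo p.1 + |v|))) p.2 :=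
    funext fun p => deriv_ppFamilyKernel hβ hΛ hB₁ hκ ht₁ hκs hlo p.1 p.2
  rw [hd]
  exact ((continuous_ppTrueKernelDu_comp hβ hΛ hB₁ continuous_fst continuous_snd).mul (continuous_familySplit hκc hlo)).add
    ((continuous_ppTrueKernel_comp hβ Λ continuous_fst continuous_snd).mul (continuous_deriv_familySplit hκ hκ'c ht₁ hκs hκ's hlo))

end Summit.HubbardSuperconductivity.HubbardSuperconductivity.Theorems.C4a

end
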